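import Summits.Parity.GeneralizedHardyLittlewood.Theses.GoldbachHeathBrownDispersion
import Literature.NumberTheory.Sieve.CubicClassTransfer
import HarnessLib

/-!
# Route `GoldbachHeathBrownDispersion` — support item `ClassTransfer` (stmt-Parity-20359, route rev 6, `1 ≤ Q`)

The by-name closing file: the Literature kernel theorem
`Literature.NumberTheory.Sieve.CubicMinorant.classTransfer` (file
`Literature/NumberTheory/Sieve/CubicClassTransfer.lean`) states the route item `ClassTransfer` verbatim, so the
item closes by `unfold; exact`.  Pattern = the accepted one-liners for `ModelMainTerm` / `ModelDispersion` /
`FourierSideComparison` of this route.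
-/

namespace Summit.Parity.GeneralizedHardyLittlewood.Theorems

/-- **`ClassTransfer` holds** (route `GoldbachHeathBrownDispersion`, support stmt-Parity-20359): for every `Q ≥ 1`,
the finite-uniform class asymptotics at `(Q, c, σ₀)` give (i) the mass bound `U ≥ (σ₀6^{-2/3}/2) η² N` and (ii) the
class discrepancies `|∑_{k≡r (d)} hbWeight c N k − locDensity(d,r) U| ≤ εU` for squarefree `d ≤ Q`, `N ≥ N₀(ε)`.
Proof: the Literature theorem `Literature.NumberTheory.Sieve.CubicMinorant.classTransfer` is this statement. -/
theorem goldbachHeathBrownDispersion_classTransfer_proof :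
    Summit.Parity.GeneralizedHardyLittlewood.Theses.GoldbachHeathBrownDispersion.ClassTransfer := by
  unfold Summit.Parity.GeneralizedHardyLittlewood.Theses.GoldbachHeathBrownDispersion.ClassTransfer
  exact Literature.NumberTheory.Sieve.CubicMinorant.classTransfer

end Summit.Parity.GeneralizedHardyLittlewood.Theorems
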